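import Summits.QuantumFields.BalabanUV.Beta.EriceRemainderEnclosureHistoryAutonomyComparisonAgeCompositionCriteriaFlow

/-!
# EriceRemainderEnclosureHistoryAutonomyComparisonAgeCompositionRowMass — (E81e) THE ROW-MASS CRITERION IN EXACT FORM AND ITS ROBUST SUBSTITUTE: the damped
# row mass of a window kernel does not increase with the pin iff the window-weighted average of the damping defects `1∕g_t − 1` is at most
# `c_n∕(c_{n+1}g_{n+k+1}) − 1` (so: ⟸ every defect in the window is); a read of a non-negative input that DECAYS across the window by the factor `Θ` is
# non-increasing as soon as «entering weight × Θ ≤ leaving weight» (no monotonicity of the row mass needed — the criterion for FAR old ages); and along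
# every box solution the relaxed damping is at least the flow's own one-step ratio, `g_t ≥ h_t∕h_{t−1}`, so every window product is at least `h_{n+k}∕h_{n+l}`

Cell `pub-balaban`, β-function sub-cell, BINDER row D4 «RemainderConst leaves for Bałaban's split» (`HOME/BINDER-OWNERS.md`; owner lineage `b2b-balaban-beta-an4`;
this file by co-owner #2 lineage `b2b-balaban-beta-d4-p2`, generation 72), β-FLOW TEAM duty (1), FREEZE (0) honoured (def-free; imports (E81d) `…CriteriaFlow`;
uses (E58b) `increment_anti`, (E48a) `strictAnti_of_memFlow`, (E75a) `prod_damping_pos` BY NAME; nothing restated).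

HONEST FRAMING (page 1, verbatim and binding).  *"Discharging BetaPertH makes Bałaban's UV stability UNCONDITIONAL — a real constructive-QFT result; it is
NOT the continuum limit and NOT the Clay problem."*  THIS FILE DISCHARGES NOTHING OF THE KIND.  Elementary real algebra about ABSTRACT window kernels and
box solutions of abstract isotone functionals — hypotheses of a census, not facts; the age profile of Bałaban's (1.22) limit functional is NOT PRINTED ([I]
p. 298; GAPS G-t4-U2-1∕-2) and NOT asserted.  Row D4 class UNCHANGED (critical-path width 0; instance 0∕1; D4 DISCHARGE NO DATE).  HONEST DEPENDENCY:
continuum YM on T⁴ ⇐ BetaPertH ∧ nine spine estimates (0/9 proved); BetaPertH ⇐ (D1) ∧ (D4) ∧ CAP+tail; G-an2-4 gates asym, D1 and NE2/3/4.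

THE POINT (census sense (α); route (N); README `g72/e81/README.md` §3 (a)).  (E81d) `flow_nonneg_of_criteria` left hypothesis (a): the damped row mass
`x̃^k_n = c_{n,k}·S_n`, `S_n = Σ_{l<k} π_{n,l}`, `π_{n,l} = Π_{t=n+1+l}^{n+k} g_t`, of every age `k ≥ 2` does not increase with the pin.  §1 makes it EXACT: the window
sums obey `S_{n+1} = g_{n+k+1}(1 + S_n − π_{n,0})` (`window_sum_succ`) and `1 − π_{n,0} = Σ_{l<k} π_{n,l}·(1∕g_{n+1+l} − 1)` (`one_sub_prod_eq`), so
`x̃_{n+1} ≤ x̃_n` ⟺ `c_{n+1}g′·Σ_l π_{n,l}f̃_{n+1+l} ≤ (c_n − c_{n+1}g′)·Σ_l π_{n,l}` (`g′ = g_{n+k+1}`, `f̃ = 1∕g − 1`): **the `π`-weighted window average of the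
damping defects must not exceed `c_n∕(c_{n+1}g′) − 1`**; **`rowmass_antitone_of_defects`**: ⟸ every defect in the window satisfies `c_{n+1}g′f̃_t ≤ c_n − c_{n+1}g′`.
§2 **`read_antitone_of_decay`**: for the OTHER regime (far old ages, where the numerics of `g72/numerics/m14.py` and README §2 show (a) to be second-order
thin and false for adversarial relaxed dampings) — a window kernel with shift domination inside the window maps a NON-NEGATIVE input that decays across the
window, `d (n+1+k) ≤ Θ·d (n+1)`, to a non-increasing read at `n` as soon as **`K (n+1) (k−1)·Θ ≤ K n 0`** (entering weight × decay ≤ leaving weight); no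
monotonicity of `d` or of the row mass is used (the young drops decay across an old window by orders of magnitude).  §3 FLOW FACTS for both: **`damping_ge_ratio`**
— along every box solution of an isotone memory with floor dominated by `L`, `1∕(1 + F_t) ≥ h_t∕h_{t−1}` (`F_t ≤ (1 − h_t²∕h_{t−1}²)∕2` by domination, and
`(q−1)²(q+2) ≥ 0`), hence every damping of the relaxed class has `g_t ≥ h_t∕h_{t−1}` and **`window_prod_ge_ratio`**: `Π_{t=a}^{b−1} g_t ≥ h_{b−1}∕h_{a−1}` — the
leaving weight `K n 0 = c_nπ_{n,0}` is at least `c_n·h_{n+k}∕h_n`; and **`flow_rowmass_of_defects`**: (a) for the age `k` at the pin `n` ⟸ `F_t·c_{n+1,k} ≤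
c_{n,k} − c_{n+1,k}` for `t ∈ [n+1, n+k]` (relaxed class), in particular ⟸ `F_{n+1} ≤ (h_{n+k}∕h_{n+k+1})³ − 1` (`flow_rowmass_of_head_defect`; the right side
is `≥ 2F_{n+k+1}` by (E81b)'s method — so (a) holds wherever the damping load at the window head is at most twice the load one pin below the window: deep
pins ∕ near ages).  NOT CLAIMED: (a) at shallow pins for far old ages (README §3: use §2 there with a quantitative MONO″); anything printed.

WHAT IS PROVED ([folklore]; 0 `def`, 0 sorry).  §1 `window_prod_succ_lag`, `one_sub_prod_eq`, `window_sum_succ`, **`rowmass_antitone_of_defects`**.  §2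
**`read_antitone_of_decay`**.  §3 `defect_le_half_level_step`, **`damping_ge_ratio`**, **`window_prod_ge_ratio`**, **`flow_rowmass_of_defects`**,
`flow_rowmass_of_head_defect`.
-/
noncomputable section
open Finset

namespace Summit.QuantumFields.BalabanUV.Beta.EriceRemainderEnclosureHistoryAutonomyComparisonAgeCompositionRowMass

open Literature.MathematicalPhysics.QuantumFieldTheory.Balaban1983to89
open Literature.MathematicalPhysics.QuantumFieldTheory.Balaban1983to89.T4BetaStationary
open Literature.MathematicalPhysics.QuantumFieldTheory.Balaban1983to89.T4BetaFlowWellPosed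
open Summit.QuantumFields.BalabanUV.Beta.EriceRemainderEnclosureHistoryAutonomyOrder (strictAnti_of_memFlow)
open Summit.QuantumFields.BalabanUV.Beta.EriceRemainderEnclosureHistoryAutonomyComparisonAffineProfile (increment_anti)
open Summit.QuantumFields.BalabanUV.Beta.EriceRemainderEnclosureHistoryAutonomyComparisonAgeCompositionIdentification (prod_damping_pos prod_damping_le_one)
open Summit.QuantumFields.BalabanUV.Beta.EriceRemainderEnclosureHistoryAutonomyComparisonAgeCompositionOneLagDecayFlow (ratio_step_mono)

/-! ## §1 Window sums: the recursion in the pin and the exact row-mass criterion -/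

section Window

variable {g : ℕ → ℝ} {k n : ℕ}

/-- Peeling the head of a window product: `Π_{t=n+1+l}^{n+k} g_t = g_{n+1+l}·Π_{t=n+2+l}^{n+k} g_t` for `l < k`. [folklore] -/
theorem window_prod_succ_lag {l : ℕ} (hl : l < k) :
    ∏ t ∈ Ico (n + 1 + l) (n + k + 1), g t = g (n + 1 + l) * ∏ t ∈ Ico (n + 1 + (l + 1)) (n + k + 1), g t := by
  rw [prod_eq_prod_Ico_succ_bot (by omega), show n + 1 + l + 1 = n + 1 + (l + 1) by ring]

/-- **THE TOTAL DAMPING OF A WINDOW AS A WEIGHTED SUM OF DEFECTS**: `1 − Π_{t=n+1}^{n+k} g_t = Σ_{l<k} (Π_{t=n+1+l}^{n+k} g_t)·(1∕g_{n+1+l} − 1)` (`g ≠ 0`;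
telescoping). [folklore] -/
theorem one_sub_prod_eq (hg : ∀ t, g t ≠ 0) :
    1 - ∏ t ∈ Ico (n + 1 + 0) (n + k + 1), g t = ∑ l ∈ range k, (∏ t ∈ Ico (n + 1 + l) (n + k + 1), g t) * (1 / g (n + 1 + l) - 1) := by
  have hstep : ∀ l ∈ range k, (∏ t ∈ Ico (n + 1 + l) (n + k + 1), g t) * (1 / g (n + 1 + l) - 1) =
      (∏ t ∈ Ico (n + 1 + (l + 1)) (n + k + 1), g t) - ∏ t ∈ Ico (n + 1 + l) (n + k + 1), g t := by
    intro l hl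
    rw [window_prod_succ_lag (mem_range.mp hl)]
    field_simp [hg (n + 1 + l)]
  rw [sum_congr rfl hstep, sum_range_sub (fun l => ∏ t ∈ Ico (n + 1 + l) (n + k + 1), g t), show n + 1 + k = n + k + 1 by ring, Ico_self,
    prod_empty]

/-- **THE WINDOW SUM ONE PIN DEEPER**: `S_{n+1} = g_{n+k+1}·(1 + S_n − π_{n,0})` with `S_n = Σ_{l<k} Π_{t=n+1+l}^{n+k} g_t` — the shifted window loses its most
damped lag and gains an undamped one, times the new entering damping. [folklore] -/
theorem window_sum_succ :
    ∑ l ∈ range k, ∏ t ∈ Ico (n + 1 + 1 + l) (n + 1 + k + 1), g t =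
      g (n + k + 1) * (1 + ∑ l ∈ range k, ∏ t ∈ Ico (n + 1 + l) (n + k + 1), g t - ∏ t ∈ Ico (n + 1 + 0) (n + k + 1), g t) := by
  have hshift : ∀ l ∈ range k, ∏ t ∈ Ico (n + 1 + 1 + l) (n + 1 + k + 1), g t = (∏ t ∈ Ico (n + 1 + (l + 1)) (n + k + 1), g t) * g (n + k + 1) := by
    intro l hl
    rw [show n + 1 + k + 1 = n + k + 1 + 1 by ring, prod_Ico_succ_top (by have := mem_range.mp hl; omega),
      show n + 1 + 1 + l = n + 1 + (l + 1) by ring]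
  rw [sum_congr rfl hshift, ← sum_mul, mul_comm]
  congr 1
  -- Σ_{l<k} π(l+1) = Σ_{l<k} π l − π 0 + π k, π k = 1
  have e := sum_range_succ' (fun l => ∏ t ∈ Ico (n + 1 + l) (n + k + 1), g t) k
  have etop : ∏ t ∈ Ico (n + 1 + k) (n + k + 1), g t = 1 := by rw [show n + 1 + k = n + k + 1 by ring, Ico_self, prod_empty]
  rw [sum_range_succ, etop] at e
  linarith

/-- **ROW MASS NON-INCREASING FROM A BOUND ON EVERY DEFECT IN THE WINDOW.**  Dampings `0 < g ≤ 1`; if for every lag `l < k`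
the defect `f̃ = 1∕g_{n+1+l} − 1` satisfies `c_{n+1}·g_{n+k+1}·f̃ ≤ c_n − c_{n+1}·g_{n+k+1}`, then `c_{n+1}·S_{n+1} ≤ c_n·S_n` (exactly: the `π`-weighted
window average of the defects is what must be bounded). [folklore] -/
theorem rowmass_antitone_of_defects {c : ℕ → ℝ} (hg : ∀ t, 0 < g t ∧ g t ≤ 1)
    (hdef : ∀ l, l < k → c (n + 1) * g (n + k + 1) * (1 / g (n + 1 + l) - 1) ≤ c n - c (n + 1) * g (n + k + 1)) :
    c (n + 1) * ∑ l ∈ range k, ∏ t ∈ Ico (n + 1 + 1 + l) (n + 1 + k + 1), g t ≤ c n * ∑ l ∈ range k, ∏ t ∈ Ico (n + 1 + l) (n + k + 1), g t := by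
  rw [window_sum_succ, show (1 : ℝ) + ∑ l ∈ range k, ∏ t ∈ Ico (n + 1 + l) (n + k + 1), g t - ∏ t ∈ Ico (n + 1 + 0) (n + k + 1), g t =
    ∑ l ∈ range k, ∏ t ∈ Ico (n + 1 + l) (n + k + 1), g t + (1 - ∏ t ∈ Ico (n + 1 + 0) (n + k + 1), g t) by ring,
    one_sub_prod_eq (fun t => (hg t).1.ne')]
  have hπ : ∀ l, 0 ≤ ∏ t ∈ Ico (n + 1 + l) (n + k + 1), g t := fun l => (prod_damping_pos hg _).le
  have key : c (n + 1) * g (n + k + 1) * ∑ l ∈ range k, (∏ t ∈ Ico (n + 1 + l) (n + k + 1), g t) * (1 / g (n + 1 + l) - 1) ≤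
      (c n - c (n + 1) * g (n + k + 1)) * ∑ l ∈ range k, ∏ t ∈ Ico (n + 1 + l) (n + k + 1), g t := by
    rw [mul_sum, mul_sum]
    refine sum_le_sum fun l hl => ?_
    rw [show c (n + 1) * g (n + k + 1) * ((∏ t ∈ Ico (n + 1 + l) (n + k + 1), g t) * (1 / g (n + 1 + l) - 1)) =
      (c (n + 1) * g (n + k + 1) * (1 / g (n + 1 + l) - 1)) * ∏ t ∈ Ico (n + 1 + l) (n + k + 1), g t by ring]
    exact mul_le_mul_of_nonneg_right (hdef l (mem_range.mp hl)) (hπ l)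
  nlinarith [key, (hg (n + k + 1)).1]

end Window

/-! ## §2 The robust substitute for far old ages: reads of inputs that decay across the window -/

/-- **READS OF A DECAYING INPUT ARE NON-INCREASING** (no monotonicity of the input or of the row mass needed).  Non-negative kernel `K` on the horizon `N`
supported in the lags `< k ≤ N`, with shift domination inside the window (`K (n+1) l ≤ K n (l+1)` for `l + 1 < k`); a NON-NEGATIVE input `d` that decays
across the window at the pin `n`: `d (n+1+k) ≤ Θ·d (n+1)`; and «ENTERING WEIGHT × DECAY ≤ LEAVING WEIGHT»: `K (n+1) (k−1)·Θ ≤ K n 0`.  Then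
`R d (n+1) ≤ R d n`. [folklore] -/
theorem read_antitone_of_decay {N k : ℕ} {K : ℕ → ℕ → ℝ} {R : (ℕ → ℝ) → ℕ → ℝ}
    (hR : ∀ v n, R v n = ∑ l ∈ range N, K n l * v (n + 1 + l)) (hK : ∀ n l, 0 ≤ K n l) (hKk : ∀ n l, k ≤ l → K n l = 0) (hk : 1 ≤ k) (hkN : k ≤ N)
    (hshift : ∀ n l, l + 1 < k → K (n + 1) l ≤ K n (l + 1))
    {d : ℕ → ℝ} (hd0 : ∀ m, 0 ≤ d m) {n : ℕ} {Θ : ℝ} (hΘ : d (n + 1 + k) ≤ Θ * d (n + 1)) (hcrit : K (n + 1) (k - 1) * Θ ≤ K n 0) :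
    R d (n + 1) ≤ R d n := by
  obtain ⟨k', rfl⟩ : ∃ k', k = k' + 1 := ⟨k - 1, by omega⟩
  -- restrict both reads to the window `range (k'+1)`
  have hres : ∀ n' (v : ℕ → ℝ), R v n' = ∑ l ∈ range (k' + 1), K n' l * v (n' + 1 + l) := by
    intro n' v
    rw [hR, ← sum_range_add_sum_Ico _ hkN, sum_eq_zero (s := Ico (k' + 1) N) fun l hl => by rw [hKk n' l (mem_Ico.mp hl).1, zero_mul], add_zero]
  rw [hres, hres, sum_range_succ (fun l => K (n + 1) l * d (n + 1 + 1 + l)) k', sum_range_succ' (fun l => K n l * d (n + 1 + l)) k']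
  have h1 : ∑ l ∈ range k', K (n + 1) l * d (n + 1 + 1 + l) ≤ ∑ l ∈ range k', K n (l + 1) * d (n + 1 + (l + 1)) :=
    sum_le_sum fun l hl => by
      rw [show n + 1 + 1 + l = n + 1 + (l + 1) by ring]
      exact mul_le_mul_of_nonneg_right (hshift n l (by have := mem_range.mp hl; omega)) (hd0 _)
  have h2 : K (n + 1) k' * d (n + 1 + 1 + k') ≤ K n 0 * d (n + 1 + 0) := by
    rw [show n + 1 + 1 + k' = n + 1 + (k' + 1) by ring, add_zero]
    calc K (n + 1) k' * d (n + 1 + (k' + 1)) ≤ K (n + 1) k' * (Θ * d (n + 1)) := mul_le_mul_of_nonneg_left hΘ (hK _ _)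
      _ = (K (n + 1) (k' + 1 - 1) * Θ) * d (n + 1) := by rw [Nat.add_sub_cancel]; ring
      _ ≤ K n 0 * d (n + 1) := mul_le_mul_of_nonneg_right hcrit (hd0 _)
  linarith

/-! ## §3 Flow facts: the relaxed damping is at least the one-step ratio; window products; (a) from defect bounds -/

section Flow

variable {B : (ℕ → ℝ) → ℝ} {γ b gIR : ℝ} {L : ℕ → ℝ} {K : ℕ} {h g : ℕ → ℝ}

/-- **THE DAMPING LOAD IS AT MOST HALF THE RELATIVE LEVEL STEP**: `F_t = Σ_{k<K} L_kh_{t+k}³∕2 ≤ (1 − h_t²∕h_{t−1}²)∕2` for `t ≥ 1` (domination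
`Σ L_ku_k ≤ B u`, `h_{t+k} ≤ h_t`, and the flow `1∕h_t² − 1∕h_{t−1}² = B(h(t+·))`). [folklore] -/
theorem defect_le_half_level_step (hL : ∀ k, 0 ≤ L k) (hb : 0 < b) (hlo : ∀ u, SeqBox γ u → b ≤ B u)
    (hdom : ∀ u, SeqBox γ u → ∑ k ∈ range K, L k * u k ≤ B u) (hh : SeqBox γ h) (hf : MemFlow B gIR h) (t : ℕ) :
    ∑ k ∈ range K, L k * h (t + 1 + k) ^ 3 / 2 ≤ (1 - h (t + 1) ^ 2 / h t ^ 2) / 2 := by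
  have hpos : ∀ n, 0 < h n := fun n => (hh n).1
  have hanti := (strictAnti_of_memFlow hb hlo hh hf).antitone
  have h0 := hpos t; have h1 := hpos (t + 1)
  have e := hf.2 t
  have hdomB : ∑ k ∈ range K, L k * h (t + 1 + k) ≤ B (fun j => h (t + 1 + j)) := hdom _ (seqBox_shift hh (t + 1))
  have hterm : ∀ k ∈ range K, L k * h (t + 1 + k) ^ 3 / 2 ≤ (h (t + 1) ^ 2 / 2) * (L k * h (t + 1 + k)) := by
    intro k _
    have hk := hpos (t + 1 + k)
    have hle : h (t + 1 + k) ≤ h (t + 1) := hanti (by omega)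
    rw [show L k * h (t + 1 + k) ^ 3 / 2 = (h (t + 1 + k) ^ 2 / 2) * (L k * h (t + 1 + k)) by ring]
    exact mul_le_mul_of_nonneg_right (by nlinarith [pow_le_pow_left₀ hk.le hle 2]) (mul_nonneg (hL k) hk.le)
  calc ∑ k ∈ range K, L k * h (t + 1 + k) ^ 3 / 2 ≤ ∑ k ∈ range K, (h (t + 1) ^ 2 / 2) * (L k * h (t + 1 + k)) := sum_le_sum hterm
    _ = (h (t + 1) ^ 2 / 2) * ∑ k ∈ range K, L k * h (t + 1 + k) := by rw [mul_sum]
    _ ≤ (h (t + 1) ^ 2 / 2) * B (fun j => h (t + 1 + j)) := mul_le_mul_of_nonneg_left hdomB (by positivity)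
    _ = (1 - h (t + 1) ^ 2 / h t ^ 2) / 2 := by
        rw [show B (fun j => h (t + 1 + j)) = 1 / h (t + 1) ^ 2 - 1 / h t ^ 2 by linarith]
        field_simp

/-- **THE RELAXED DAMPING IS AT LEAST THE ONE-STEP RATIO**: `1∕(1 + F_{t+1}) ≥ h_{t+1}∕h_t`, hence `g_{t+1} ≥ h_{t+1}∕h_t` for every damping of the relaxed
class (`1 + (1−q²)∕2 ≤ 1∕q` ⟺ `(q−1)²(q+2) ≥ 0`). [folklore] -/
theorem damping_ge_ratio (hL : ∀ k, 0 ≤ L k) (hb : 0 < b) (hlo : ∀ u, SeqBox γ u → b ≤ B u)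
    (hdom : ∀ u, SeqBox γ u → ∑ k ∈ range K, L k * u k ≤ B u) (hh : SeqBox γ h) (hf : MemFlow B gIR h)
    (hgF : ∀ t, 1 / (1 + ∑ k ∈ range K, L k * h (t + k) ^ 3 / 2) ≤ g t) (t : ℕ) : h (t + 1) / h t ≤ g (t + 1) := by
  have hpos : ∀ n, 0 < h n := fun n => (hh n).1
  have h0 := hpos t; have h1 := hpos (t + 1)
  have hanti := (strictAnti_of_memFlow hb hlo hh hf).antitone
  have hF := defect_le_half_level_step hL hb hlo hdom hh hf t
  have hF0 : 0 ≤ ∑ k ∈ range K, L k * h (t + 1 + k) ^ 3 / 2 := sum_nonneg fun k _ => by have := hL k; have := hpos (t + 1 + k); positivity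
  refine le_trans ?_ (hgF (t + 1))
  set q := h (t + 1) / h t with hq
  have hq0 : 0 < q := by positivity
  have hq1 : q ≤ 1 := by rw [hq, div_le_one h0]; exact hanti (Nat.le_succ t)
  have hqq : h (t + 1) ^ 2 / h t ^ 2 = q ^ 2 := by rw [hq, div_pow]
  rw [hqq] at hF
  -- q (1 + F) ≤ q (1 + (1 − q²)/2) ≤ 1
  rw [le_div_iff₀ (by linarith), show ∑ k ∈ range K, L k * h (t + 1 + k) ^ 3 / 2 = ∑ k ∈ range K, L k * h (t + 1 + k) ^ 3 / 2 from rfl]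
  nlinarith [mul_le_mul_of_nonneg_left hF hq0.le, sq_nonneg (q - 1), mul_nonneg (sq_nonneg (q - 1)) hq0.le]

/-- **WINDOW PRODUCTS ARE AT LEAST LEVEL RATIOS**: `Π_{t ∈ [a+1, a+1+m)} g_t ≥ h_{a+m}∕h_a` for every damping of the relaxed class. [folklore] -/
theorem window_prod_ge_ratio (hL : ∀ k, 0 ≤ L k) (hb : 0 < b) (hlo : ∀ u, SeqBox γ u → b ≤ B u)
    (hdom : ∀ u, SeqBox γ u → ∑ k ∈ range K, L k * u k ≤ B u) (hh : SeqBox γ h) (hf : MemFlow B gIR h)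
    (hg : ∀ t, 0 < g t ∧ g t ≤ 1) (hgF : ∀ t, 1 / (1 + ∑ k ∈ range K, L k * h (t + k) ^ 3 / 2) ≤ g t) (a m : ℕ) :
    h (a + m) / h a ≤ ∏ t ∈ Ico (a + 1) (a + 1 + m), g t := by
  have hpos : ∀ n, 0 < h n := fun n => (hh n).1
  induction m with
  | zero => simp [(hpos a).ne']
  | succ m ih =>
    rw [show a + 1 + (m + 1) = a + 1 + m + 1 by ring, prod_Ico_succ_top (by omega), show a + 1 + m = a + m + 1 by ring]
    have hstep := damping_ge_ratio hL hb hlo hdom hh hf hgF (a + m)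
    have hP : 0 ≤ ∏ t ∈ Ico (a + 1) (a + m + 1), g t := (prod_damping_pos hg _).le
    calc h (a + (m + 1)) / h a = (h (a + m) / h a) * (h (a + m + 1) / h (a + m)) := by
          rw [show a + (m + 1) = a + m + 1 by ring, div_mul_div_comm, mul_comm (h (a + m)) (h (a + m + 1)),
            mul_div_mul_right _ _ (hpos (a + m)).ne']
      _ ≤ (∏ t ∈ Ico (a + 1) (a + m + 1), g t) * g (a + m + 1) := by
          rw [show a + 1 + m = a + m + 1 by ring] at ih
          exact mul_le_mul ih hstep (by have := hpos (a + m); have := hpos (a + m + 1); positivity) hP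

/-- **(a) FROM DEFECT BOUNDS, FOR THE FLOW.**  For the age `k` (`1 ≤ k < K`) at the pin `n`: if the damping load at every depth of the window satisfies
`F_t·c_{n+1,k} ≤ c_{n,k} − c_{n+1,k}` (`t ∈ [n+1, n+k]`, `c_{n,k} = L_kh_{n+k}³∕2`), then the damped row mass does not increase: `x̃^k_{n+1} ≤ x̃^k_n` (relaxed
class: `1∕g_t − 1 ≤ F_t`, `g_{n+k+1} ≤ 1`; §1 `rowmass_antitone_of_defects`). [folklore] -/
theorem flow_rowmass_of_defects (hL : ∀ k, 0 ≤ L k) (hh0 : ∀ n, 0 < h n)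
    (hg : ∀ t, 0 < g t ∧ g t ≤ 1) (hgF : ∀ t, 1 / (1 + ∑ k ∈ range K, L k * h (t + k) ^ 3 / 2) ≤ g t)
    {KL : ℕ → ℕ → ℕ → ℝ}
    (hKL : ∀ k n l, KL k n l = if 0 < k ∧ k < K ∧ l < k then L k * h (n + k) ^ 3 / 2 * ∏ t ∈ Ico (n + 1 + l) (n + k + 1), g t else 0)
    {k : ℕ} (hk1 : 1 ≤ k) (hkK : k < K) {n : ℕ}
    (hdef : ∀ t, n + 1 ≤ t → t ≤ n + k → (∑ j ∈ range K, L j * h (t + j) ^ 3 / 2) * (L k * h (n + 1 + k) ^ 3 / 2) ≤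
      L k * h (n + k) ^ 3 / 2 - L k * h (n + 1 + k) ^ 3 / 2) :
    ∑ l ∈ range k, KL k (n + 1) l ≤ ∑ l ∈ range k, KL k n l := by
  have e : ∀ n' l, l ∈ range k → KL k n' l = (L k * h (n' + k) ^ 3 / 2) * ∏ t ∈ Ico (n' + 1 + l) (n' + k + 1), g t :=
    fun n' l hl => by rw [hKL, if_pos ⟨by omega, hkK, mem_range.mp hl⟩]
  rw [sum_congr rfl (e (n + 1)), sum_congr rfl (e n), ← mul_sum, ← mul_sum]
  have hc0 : 0 ≤ L k * h (n + 1 + k) ^ 3 / 2 := by have := hL k; have := hh0 (n + 1 + k); positivity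
  refine rowmass_antitone_of_defects (c := fun n' => L k * h (n' + k) ^ 3 / 2) hg fun l hl => ?_
  have hFt := hdef (n + 1 + l) (by omega) (by omega)
  have hF0 : 0 ≤ ∑ j ∈ range K, L j * h (n + 1 + l + j) ^ 3 / 2 := sum_nonneg fun j _ => by have := hL j; have := hh0 (n + 1 + l + j); positivity
  -- 1/g − 1 ≤ F at t = n+1+l, and g' ≤ 1
  have hgt := hgF (n + 1 + l)
  have hg0 := (hg (n + 1 + l)).1
  have hdefect : 1 / g (n + 1 + l) - 1 ≤ ∑ j ∈ range K, L j * h (n + 1 + l + j) ^ 3 / 2 := by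
    have h1F : 0 < 1 + ∑ j ∈ range K, L j * h (n + 1 + l + j) ^ 3 / 2 := by positivity
    have hg1F := (div_le_iff₀ h1F).mp hgt
    have : 1 / g (n + 1 + l) ≤ 1 + ∑ j ∈ range K, L j * h (n + 1 + l + j) ^ 3 / 2 := by rw [div_le_iff₀ hg0]; linarith
    linarith
  have hf0 : 0 ≤ 1 / g (n + 1 + l) - 1 := by linarith [one_le_one_div hg0 (hg (n + 1 + l)).2]
  have hg'1 := (hg (n + k + 1)).2
  have hg'0 := (hg (n + k + 1)).1
  set c' := L k * h (n + 1 + k) ^ 3 / 2 with hc'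
  have h1 : c' * g (n + k + 1) * (1 / g (n + 1 + l) - 1) ≤ c' * (1 / g (n + 1 + l) - 1) := by
    have := mul_le_mul_of_nonneg_left hg'1 (mul_nonneg hc0 hf0); nlinarith
  have h2 : c' * (1 / g (n + 1 + l) - 1) ≤ c' * ∑ j ∈ range K, L j * h (n + 1 + l + j) ^ 3 / 2 := mul_le_mul_of_nonneg_left hdefect hc0
  have h4 : c' * g (n + k + 1) ≤ c' := by nlinarith
  nlinarith [hFt]

/-- In particular (the damping load `F_t` is non-increasing in `t` along the flow): **`F_{n+1}·c_{n+1,k} ≤ c_{n,k} − c_{n+1,k}` ⟹ `x̃^k_{n+1} ≤ x̃^k_n`** —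
the damping load at the head of the window against the relative kernel step `(h_{n+k}∕h_{n+k+1})³ − 1` (`≥ 2F_{n+k+1}` by (E81b) `level_step_ge`'s method).
[folklore] -/
theorem flow_rowmass_of_head_defect (hL : ∀ k, 0 ≤ L k)
    (hb : 0 < b) (hlo : ∀ u, SeqBox γ u → b ≤ B u) (hh : SeqBox γ h) (hf : MemFlow B gIR h)
    (hg : ∀ t, 0 < g t ∧ g t ≤ 1) (hgF : ∀ t, 1 / (1 + ∑ k ∈ range K, L k * h (t + k) ^ 3 / 2) ≤ g t)
    {KL : ℕ → ℕ → ℕ → ℝ}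
    (hKL : ∀ k n l, KL k n l = if 0 < k ∧ k < K ∧ l < k then L k * h (n + k) ^ 3 / 2 * ∏ t ∈ Ico (n + 1 + l) (n + k + 1), g t else 0)
    {k : ℕ} (hk1 : 1 ≤ k) (hkK : k < K) {n : ℕ}
    (hhead : (∑ j ∈ range K, L j * h (n + 1 + j) ^ 3 / 2) * (L k * h (n + 1 + k) ^ 3 / 2) ≤ L k * h (n + k) ^ 3 / 2 - L k * h (n + 1 + k) ^ 3 / 2) :
    ∑ l ∈ range k, KL k (n + 1) l ≤ ∑ l ∈ range k, KL k n l := by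
  have hh0 : ∀ n, 0 < h n := fun n => (hh n).1
  have hanti := (strictAnti_of_memFlow hb hlo hh hf).antitone
  refine flow_rowmass_of_defects hL hh0 hg hgF hKL hk1 hkK fun t ht1 ht2 => le_trans ?_ hhead
  have hc0 : 0 ≤ L k * h (n + 1 + k) ^ 3 / 2 := by have := hL k; have := hh0 (n + 1 + k); positivity
  refine mul_le_mul_of_nonneg_right (sum_le_sum fun j _ => ?_) hc0
  have := pow_le_pow_left₀ (hh0 (t + j)).le (hanti (by omega : n + 1 + j ≤ t + j)) 3
  have := hL j
  nlinarith

end Flow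

end Summit.QuantumFields.BalabanUV.Beta.EriceRemainderEnclosureHistoryAutonomyComparisonAgeCompositionRowMass

end
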